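/-
Copyright: the b2b-balaban T⁴-continuum CRUX team, row NE7b OWNER lineage `t4-ne7b-p1` (gen 145). Project licence.
-/
import Summits.QuantumFields.BalabanUV.T4Continuum.Spine.NE7b.SupWeightedTwoPointMastersTwo

/-!
# THE WEIGHTED OUTPUT LETTERS AT ORDER THREE — THE WEIGHTED CLASS CLOSES FOR `K3` (SCOPING-d17 (R-c), the template for orders 4–5).
# (479)∕(483): the output's third-order majorant is `K3⁺_{xyv} = M₃(v;x,y) = K3_{xyv} + E_D(g^{vy},b^x) + E_D(g^{vx},b^y) + E_D(b^v,g^{xy}) +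
# C₃∕(ρ_{vx}ρ_{vy})` (`g^{pq}_{z′} = Σ_u|A_{uz′}|K3_{pqu}`, `b^v_{z′} = Σ_u|A_{uz′}|Hk_{vu}`); (482) summed it with each slot fixed against PLAIN
# letters.  THE WEIGHTED CLASS (SCOPING-d17 §D, DECISION here): the slot letters of a majorant are FULL-GRAPH weighted — `Σ_{free} K3_{xyv}·
# ϑ₂(x,y)ϑ₂(x,v)ϑ₂(y,v)` with one index fixed (three roles) — at the INPUT weight `ϑ₂`, and the step must reproduce them at the OUTPUT weight
# `ϑ` with `ϑ ≥ 1` symmetric submultiplicative, `ϑ² ≤ ϑ₂` and `ϑ_{xy}² ≤ σ_{xw}σ_{yw}` (the doubled edge routed through the sampler index of `E_D`).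
# Full-graph (not star) weights are what closes: on a triangle with apex `a`, `ϑ_{ab}ϑ_{ac}ϑ_{bc} ≤ ϑ_{ab}²ϑ_{ac}²` (one `have`), so every term
# is routed with SQUARED star edges, and squares are exactly what `ϑ² ≤ ϑ₂`, `ϑ² ≤ σσ` absorb — no stray single powers.  THIS FILE: the three
# weighted output letters
#   `Σ_{y,z} M₃(v;y,z)·ϑ_{vy}ϑ_{vz}ϑ_{yz} ≤ k3cϑ + (2·dθ·αg1m·dθ′·αθc + dθ·αθ·dθ′·αg1c)∕(1−lamA) + C₃·Sϑ2²`            (`v` fixed),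
#   `Σ_{y,v} M₃(v;x,y)·ϑ_{xy}ϑ_{xv}ϑ_{yv} ≤ k3rϑ + (dθ·αθ·dθ′·αg1c + dθ·αg2m·dθ′·αθc + dθ·αg1m·dθ′·αθc)∕(1−lamA) + C₃·Sϑ2²`   (`x` fixed),
#   `Σ_{x,v} M₃(v;x,y)·ϑ_{yx}ϑ_{yv}ϑ_{xv} ≤ k3mϑ + (2·dθ·αg2m·dθ′·αθc + dθ·αθ·dθ′·αg1c)∕(1−lamA) + C₃·Sϑ2²`            (`y` fixed),
# from the masters (653)∕(656), with the PROFILE letters as hypotheses — the gradient vectors' row∕column profiles `αθ, αθc` (class's `haσ` + the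
# column twin), the `K3`-family's `ϑ₂`-weighted first- and second-index masses `αg1m, αg2m` and its column letter with internal weight `αg1c`
# (each ≤ a full-graph `ϑ₂`-letter times the factor's weighted letter by a (651)-type transport — supplement file) — and ONE geometry letter
# `Sϑ2 = sup_vΣ_xϑ_{vx}²∕ρ_{vx}` (row NE7b, node U5c; (653), (656) BY NAME; Mathlib only otherwise; [folklore]).  (482)'s shapes with
# `αr·k3r ↦ αg1m`, `αr·k3m ↦ αg2m`, `αc·k3c ↦ αg1c`, `hr·αr ↦ αθ`, `αc·hc ↦ αθc`, `dr,dc ↦ dθ,dθ′`, `S² ↦ Sϑ2²`; no support count, no range.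

Cell `pub-balaban`, sub-cell `t4`, spine estimate NE7b (`T4WeightBudget.RelWeightBound`; the cell's OWN estimate — NOT PRINTED in
[Bałaban 1983–89], NOT PROVED).  Crux-route work under `Spine/NE7b/` by the row OWNER (`t4-ne7b-p1` gen 145, file (657)) under FREEZE
(0)'s crux-prover clause; NOTHING of Bałaban's is named as a Lean object, valued or asserted; no `T4Continuum/Support` leaf typed; no
`def`, no notation (`M₃` WRITTEN OUT in (482)'s letters); zero `sorry`.  Imports (BY NAME): the OWNER's (656) `…SupWeightedTwoPointMastersTwo`
((653) through it).

WHAT IS PROVED ([folklore]): §1 `tree_sq_sum_le`, `tree_sq_sum_le'` (the tree term against squared star edges); §2 THE ENDS **`output_k3cϑ`**,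
**`output_k3rϑ`** (the third role `output_k3mϑ` is the next file, (658) — 400-line cap); §3 toy.

HONEST (what this is NOT).  Order 3 of (R-c); the profile letters' discharge from the full-graph `ϑ₂`-letters (supplement), orders 4–5 (with the
interpolated terms) and the rate bookkeeping (`ϑ₂ = ϑ²`: the weight RATE halves per step before rescaling) are the next files; scalar skeleton
((A3), NC-NE7b-α UNRULED); nothing of Bałaban's asserted.  BY-NAME EFFECT ON THE WALL: NONE.  NE7b NOT PRINTED ∕ NOT PROVED; spine PROVED 0∕9;
rung (B)+1 — the programme's measures remain FINITE-torus statements; NOT the mass gap, NOT Clay.  HONEST DEPENDENCY: continuum YM on T⁴ ⇐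
BetaPertH ∧ nine spine estimates (0∕9 proved); BetaPertH ⇐ (D1) ∧ (D4) ∧ CAP+tail; G-an2-4 gates asym, D1 and NE2∕3∕4.
-/

set_option autoImplicit false

noncomputable section

namespace Summit.QuantumFields.BalabanUV.T4Continuum.NE7b.SupWeightedThirdOrderLetters

open Finset Real Matrix
open scoped BigOperators
open SupWeightedTwoPointMasters (weighted_two_point_family_le weighted_two_point_family_le')
open SupWeightedTwoPointMastersTwo (weighted_two_point_two_families_le weighted_two_point_two_families_le')

variable {ι κ : Type} [Fintype ι] [Fintype κ]

variable {Hk : ι → ι → ℝ} {K3 : ι → ι → ι → ℝ} {A : Matrix ι κ ℝ} {D : κ → κ → ℝ} {ϑ ϑ₂ ρ : ι → ι → ℝ} {σ : ι → κ → ℝ} {θ : κ → κ → ℝ}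
  {γop κ₂ lam lamA dθ dθ' αθ βθ αθc αg1m αg2m αg1c k3cϑ k3rϑ k3mϑ Sϑ2 : ℝ}

/-! ## §1. The tree term against squared star edges -/

omit [Fintype κ] in
/-- **Apex at the tree's centre**: `Σ_{x,y}ϑ_{vx}²ϑ_{vy}²∕(ρ_{vx}ρ_{vy}) ≤ Sϑ2²`. [folklore] -/
theorem tree_sq_sum_le (hρ0 : ∀ x y, 0 < ρ x y) (hS2 : ∀ v, ∑ x, ϑ v x * ϑ v x / ρ v x ≤ Sϑ2) (v : ι) :
    ∑ x, ∑ y, (ϑ v x * ϑ v x) * (ϑ v y * ϑ v y) / (ρ v x * ρ v y) ≤ Sϑ2 ^ 2 := by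
  have hS0 : 0 ≤ Sϑ2 := (sum_nonneg fun x _ => div_nonneg (mul_self_nonneg _) (hρ0 v x).le).trans (hS2 v)
  calc ∑ x, ∑ y, (ϑ v x * ϑ v x) * (ϑ v y * ϑ v y) / (ρ v x * ρ v y) = (∑ x, ϑ v x * ϑ v x / ρ v x) * (∑ y, ϑ v y * ϑ v y / ρ v y) := by
        rw [sum_mul_sum]; exact sum_congr rfl fun x _ => sum_congr rfl fun y _ => by rw [div_mul_div_comm]
    _ ≤ Sϑ2 * Sϑ2 := mul_le_mul (hS2 v) (hS2 v) (sum_nonneg fun y _ => div_nonneg (mul_self_nonneg _) (hρ0 v y).le) hS0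
    _ = Sϑ2 ^ 2 := by ring

omit [Fintype κ] in
/-- **Apex off the centre** (`x` fixed, tree centred at the summed `v`): `Σ_{y,v}ϑ_{xv}²ϑ_{vy}²∕(ρ_{vx}ρ_{vy}) ≤ Sϑ2²`. [folklore] -/
theorem tree_sq_sum_le' (hρ0 : ∀ x y, 0 < ρ x y) (hρsymm : ∀ x y, ρ x y = ρ y x)
    (hS2 : ∀ v, ∑ x, ϑ v x * ϑ v x / ρ v x ≤ Sϑ2) (x : ι) :
    ∑ y, ∑ v, (ϑ x v * ϑ x v) * (ϑ v y * ϑ v y) / (ρ v x * ρ v y) ≤ Sϑ2 ^ 2 := by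
  have hS0 : 0 ≤ Sϑ2 := (sum_nonneg fun y _ => div_nonneg (mul_self_nonneg _) (hρ0 x y).le).trans (hS2 x)
  calc ∑ y, ∑ v, (ϑ x v * ϑ x v) * (ϑ v y * ϑ v y) / (ρ v x * ρ v y) = ∑ v, (ϑ x v * ϑ x v / ρ x v) * ∑ y, ϑ v y * ϑ v y / ρ v y := by
        rw [sum_comm]
        refine sum_congr rfl fun v _ => ?_
        rw [mul_sum]
        exact sum_congr rfl fun y _ => by rw [div_mul_div_comm, hρsymm v x]
    _ ≤ ∑ v, (ϑ x v * ϑ x v / ρ x v) * Sϑ2 := sum_le_sum fun v _ => mul_le_mul_of_nonneg_left (hS2 v) (div_nonneg (mul_self_nonneg _) (hρ0 x v).le)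
    _ = (∑ v, ϑ x v * ϑ x v / ρ x v) * Sϑ2 := by rw [sum_mul]
    _ ≤ Sϑ2 * Sϑ2 := mul_le_mul_of_nonneg_right (hS2 x) hS0
    _ = Sϑ2 ^ 2 := by ring

/-! ## §2. THE ENDS: the three weighted output letters of `K3⁺ = M₃` -/

/-- **`k3cϑ⁺`** (`v` fixed — the third index; full-graph weight `ϑ_{vy}ϑ_{vz}ϑ_{yz}`). [folklore] -/
theorem output_k3cϑ (hK30 : ∀ x y u, 0 ≤ K3 x y u) (hHk0 : ∀ v u, 0 ≤ Hk v u) (hD : ∀ x y, 0 ≤ D x y) (hlamA1 : lamA < 1)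
    (hθnn : ∀ z w, 0 ≤ θ z w) (hDr : ∀ z', ∑ w, D z' w * θ z' w ≤ dθ) (hdθ : 0 ≤ dθ) (hDc : ∀ w, ∑ z', D z' w * θ z' w ≤ dθ') (hdθ' : 0 ≤ dθ')
    (hσ0 : ∀ x w, 0 ≤ σ x w) (hσθ : ∀ x z' w, σ x w ≤ σ x z' * θ z' w)
    (hϑ1 : ∀ x y, 1 ≤ ϑ x y) (hϑsymm : ∀ x y, ϑ x y = ϑ y x) (hϑmul : ∀ x y z, ϑ x z ≤ ϑ x y * ϑ y z) (hϑ2 : ∀ x y, ϑ x y * ϑ x y ≤ ϑ₂ x y)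
    (hϑ₂1 : ∀ x y, 1 ≤ ϑ₂ x y) (hϑσ : ∀ x y w, ϑ x y * ϑ x y ≤ σ x w * σ y w) (hρ0 : ∀ x y, 0 < ρ x y)
    (hS2 : ∀ v, ∑ x, ϑ v x * ϑ v x / ρ v x ≤ Sϑ2) (hCT : 0 ≤ 4 * Real.sqrt (5 * (κ₂ ^ 4 * γop ^ 2) / (1 - lam * γop) ^ 2 * (αθ * dθ * (βθ * dθ') /
        (1 - lamA))))
    (hbσ : ∀ v, ∑ z', (∑ u, |A u z'| * Hk v u) * σ v z' ≤ αθ) (hbσc : ∀ z', ∑ v, (∑ u, |A u z'| * Hk v u) * σ v z' ≤ αθc) (hαθc : 0 ≤ αθc)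
    (hg1m : ∀ x, ∑ y, ϑ₂ x y * ∑ z', (∑ u, |A u z'| * K3 x y u) * σ x z' ≤ αg1m)
    (hg1c : ∀ z', ∑ x, ∑ y, (∑ u, |A u z'| * K3 x y u) * (σ x z' * ϑ₂ x y) ≤ αg1c) (hαg1c : 0 ≤ αg1c)
    (hk3c : ∀ v, ∑ y, ∑ z, K3 y z v * (ϑ₂ v y * ϑ₂ v z * ϑ₂ y z) ≤ k3cϑ) (v : ι) :
    ∑ y, ∑ z, (K3 y z v + ∑ w, (∑ z', D z' w * ∑ u, |A u z'| * K3 v z u) * (∑ z', D z' w * ∑ u, |A u z'| * Hk y u) / (1 - lamA) + ∑ w, (∑ z', D z'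
        w * ∑ u, |A u z'| * K3 v y u) * (∑ z', D z' w * ∑ u, |A u z'| * Hk z u) / (1 - lamA) + ∑ w, (∑ z', D z' w * ∑ u, |A u z'| * Hk v u) * (∑
        z', D z' w * ∑ u, |A u z'| * K3 y z u) / (1 - lamA) + 4 * Real.sqrt (5 * (κ₂ ^ 4 * γop ^ 2) / (1 - lam * γop) ^ 2 * (αθ * dθ * (βθ * dθ') /
        (1 - lamA))) / (ρ v y * ρ v z)) * (ϑ v y * ϑ v z * ϑ y z) ≤
      k3cϑ + (2 * (dθ * αg1m * (dθ' * αθc) / (1 - lamA)) + dθ * αθ * (dθ' * αg1c) / (1 - lamA)) + 4 * Real.sqrt (5 * (κ₂ ^ 4 * γop ^ 2) / (1 - lam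
        * γop) ^ 2 * (αθ * dθ * (βθ * dθ') / (1 - lamA))) * Sϑ2 ^ 2 := by
  have hl : 0 < 1 - lamA := by linarith
  have hϑ0 : ∀ x y, 0 ≤ ϑ x y := fun x y => zero_le_one.trans (hϑ1 x y)
  have hϑ₂0 : ∀ x y, 0 ≤ ϑ₂ x y := fun x y => zero_le_one.trans (hϑ₂1 x y)
  have hϑϑ₂ : ∀ x y, ϑ x y ≤ ϑ₂ x y := fun x y => le_trans (by nlinarith [hϑ1 x y]) (hϑ2 x y)
  have hg0 : ∀ (p q : ι) (z' : κ), 0 ≤ ∑ u, |A u z'| * K3 p q u := fun p q z' => sum_nonneg fun u _ => mul_nonneg (abs_nonneg _) (hK30 p q u)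
  have hb0 : ∀ (r : ι) (z' : κ), 0 ≤ ∑ u, |A u z'| * Hk r u := fun r z' => sum_nonneg fun u _ => mul_nonneg (abs_nonneg _) (hHk0 r u)
  have hE0 : ∀ (p q r : ι), 0 ≤ ∑ w, (∑ z', D z' w * ∑ u, |A u z'| * K3 p q u) * (∑ z', D z' w * ∑ u, |A u z'| * Hk r u) / (1 - lamA) :=
    fun p q r => sum_nonneg fun w _ => div_nonneg (mul_nonneg (sum_nonneg fun z' _ => mul_nonneg (hD z' w) (hg0 p q z'))
      (sum_nonneg fun z' _ => mul_nonneg (hD z' w) (hb0 r z'))) hl.le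
  have hE0' : ∀ (p q r : ι), 0 ≤ ∑ w, (∑ z', D z' w * ∑ u, |A u z'| * Hk r u) * (∑ z', D z' w * ∑ u, |A u z'| * K3 p q u) / (1 - lamA) :=
    fun p q r => sum_nonneg fun w _ => div_nonneg (mul_nonneg (sum_nonneg fun z' _ => mul_nonneg (hD z' w) (hb0 r z'))
      (sum_nonneg fun z' _ => mul_nonneg (hD z' w) (hg0 p q z'))) hl.le
  -- the full-graph weight on a triangle with apex `a`: `ϑab·ϑac·ϑbc ≤ ϑab²·ϑac²`
  have hW : ∀ a b c, ϑ a b * ϑ a c * ϑ b c ≤ (ϑ a b * ϑ a b) * (ϑ a c * ϑ a c) := fun a b c => by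
    have h := hϑmul b a c; rw [hϑsymm b a] at h
    calc ϑ a b * ϑ a c * ϑ b c ≤ ϑ a b * ϑ a c * (ϑ a b * ϑ a c) := mul_le_mul_of_nonneg_left h (mul_nonneg (hϑ0 a b) (hϑ0 a c))
      _ = (ϑ a b * ϑ a b) * (ϑ a c * ϑ a c) := by ring
  have hW1 : ∀ a b c, ϑ a b * ϑ a c * ϑ b c ≤ ϑ₂ a b * (ϑ a c * ϑ a c) := fun a b c =>
    (hW a b c).trans (mul_le_mul_of_nonneg_right (hϑ2 a b) (mul_self_nonneg _))
  have hW2 : ∀ a b c, ϑ a b * ϑ a c * ϑ b c ≤ (ϑ a b * ϑ a b) * ϑ₂ a c := fun a b c =>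
    (hW a b c).trans (mul_le_mul_of_nonneg_left (hϑ2 a c) (mul_self_nonneg _))
  have hW3 : ∀ a b c, ϑ a b * ϑ a c * ϑ b c ≤ ϑ₂ a b * ϑ₂ a c * ϑ₂ b c := fun a b c =>
    mul_le_mul (mul_le_mul (hϑϑ₂ a b) (hϑϑ₂ a c) (hϑ0 a c) (hϑ₂0 a b)) (hϑϑ₂ b c) (hϑ0 b c) (mul_nonneg (hϑ₂0 a b) (hϑ₂0 a c))
  -- T1
  have h1 : ∑ y, ∑ z, K3 y z v * (ϑ v y * ϑ v z * ϑ y z) ≤ k3cϑ :=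
    (sum_le_sum fun y _ => sum_le_sum fun z _ => mul_le_mul_of_nonneg_left (hW3 v y z) (hK30 y z v)).trans (hk3c v)
  -- T2: anchor family z ↦ g^{vz} (α = ϑ₂ v z), leg y (β = ϑvy²); anchor factor first
  have h2 : ∑ y, ∑ z, (∑ w, (∑ z', D z' w * ∑ u, |A u z'| * K3 v z u) * (∑ z', D z' w * ∑ u, |A u z'| * Hk y u) / (1 - lamA)) * (ϑ v y * ϑ v z * ϑ
        y z) ≤ dθ * αg1m * (dθ' * αθc) / (1 - lamA) := by
    have h := weighted_two_point_two_families_le' (R := ι) (S := ι) (g := fun z z' => ∑ u, |A u z'| * K3 v z u) (α := fun z => ϑ₂ v z)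
      (b := fun y z' => ∑ u, |A u z'| * Hk y u) (σ := fun w => σ v w) (σ₁ := fun z' => σ v z') (σ' := fun y w => σ y w) (σ'₁ := fun y z' => σ y z')
      (β := fun y => ϑ v y * ϑ v y) (fun z z' => hg0 v z z') (fun z => hϑ₂0 v z) (fun y z' => hb0 y z') hD hθnn (fun w => hσ0 v w)
      (fun z' => hσ0 v z') (fun y w => hϑσ v y w) (fun z' w => hσθ v z' w) (fun y z' w => hσθ y z' w) hDr hdθ hDc hdθ' (hg1m v) hbσc hαθc hlamA1
    rw [sum_comm] at h
    refine le_trans (sum_le_sum fun y _ => sum_le_sum fun z _ => ?_) h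
    calc _ ≤ (∑ w, (∑ z', D z' w * ∑ u, |A u z'| * K3 v z u) * (∑ z', D z' w * ∑ u, |A u z'| * Hk y u) / (1 - lamA)) * (ϑ₂ v z * (ϑ v y * ϑ v y))
        := mul_le_mul_of_nonneg_left (by
            calc (ϑ v y * ϑ v z * ϑ y z) ≤ (ϑ v y * ϑ v y) * (ϑ v z * ϑ v z) := hW v y z
              _ ≤ (ϑ v y * ϑ v y) * ϑ₂ v z := mul_le_mul_of_nonneg_left (hϑ2 v z) (mul_self_nonneg _)
              _ = ϑ₂ v z * (ϑ v y * ϑ v y) := by ring) (hE0 v z y)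
      _ = _ := rfl
  -- T3: anchor family y ↦ g^{vy}, leg z
  have h3 : ∑ y, ∑ z, (∑ w, (∑ z', D z' w * ∑ u, |A u z'| * K3 v y u) * (∑ z', D z' w * ∑ u, |A u z'| * Hk z u) / (1 - lamA)) * (ϑ v y * ϑ v z * ϑ
        y z) ≤ dθ * αg1m * (dθ' * αθc) / (1 - lamA) := by
    have h := weighted_two_point_two_families_le' (R := ι) (S := ι) (g := fun y z' => ∑ u, |A u z'| * K3 v y u) (α := fun y => ϑ₂ v y)
      (b := fun z z' => ∑ u, |A u z'| * Hk z u) (σ := fun w => σ v w) (σ₁ := fun z' => σ v z') (σ' := fun z w => σ z w) (σ'₁ := fun z z' => σ z z')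
      (β := fun z => ϑ v z * ϑ v z) (fun y z' => hg0 v y z') (fun y => hϑ₂0 v y) (fun z z' => hb0 z z') hD hθnn (fun w => hσ0 v w)
      (fun z' => hσ0 v z') (fun z w => hϑσ v z w) (fun z' w => hσθ v z' w) (fun z z' w => hσθ z z' w) hDr hdθ hDc hdθ' (hg1m v) hbσc hαθc hlamA1
    refine le_trans (sum_le_sum fun y _ => sum_le_sum fun z _ => ?_) h
    exact mul_le_mul_of_nonneg_left ((hW1 v y z).trans (le_of_eq (by ring))) (hE0 v y z)
  -- T4: one-point anchor b^v, leg family (y,z) with internal weight ϑ₂ y z: W ≤ ϑvy²·ϑ₂yz ≤ σvw·(σyw·ϑ₂yz)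
  have h4 : ∑ y, ∑ z, (∑ w, (∑ z', D z' w * ∑ u, |A u z'| * Hk v u) * (∑ z', D z' w * ∑ u, |A u z'| * K3 y z u) / (1 - lamA)) * (ϑ v y * ϑ v z * ϑ
        y z) ≤ dθ * αθ * (dθ' * αg1c) / (1 - lamA) := by
    have hβ : ∀ (p : ι × ι) (w : κ), ϑ v p.1 * ϑ v p.1 * ϑ₂ p.1 p.2 ≤ σ v w * (σ p.1 w * ϑ₂ p.1 p.2) := fun p w => by
      calc ϑ v p.1 * ϑ v p.1 * ϑ₂ p.1 p.2 ≤ σ v w * σ p.1 w * ϑ₂ p.1 p.2 := mul_le_mul_of_nonneg_right (hϑσ v p.1 w) (hϑ₂0 p.1 p.2)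
        _ = σ v w * (σ p.1 w * ϑ₂ p.1 p.2) := by ring
    have h := weighted_two_point_family_le' (R := ι × ι) (a := fun z' => ∑ u, |A u z'| * Hk v u) (b := fun p z' => ∑ u, |A u z'| * K3 p.1 p.2 u)
      (σ := fun w => σ v w) (σ₁ := fun z' => σ v z') (σ' := fun p w => σ p.1 w * ϑ₂ p.1 p.2) (σ'₁ := fun p z' => σ p.1 z' * ϑ₂ p.1 p.2)
      (ϑ := fun p => ϑ v p.1 * ϑ v p.1 * ϑ₂ p.1 p.2) (fun z' => hb0 v z') (fun p z' => hg0 p.1 p.2 z') hD hθnn (fun w => hσ0 v w) (fun z' => hσ0 v z')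
      hβ (fun z' w => hσθ v z' w) (fun p z' w => by
        calc σ p.1 w * ϑ₂ p.1 p.2 ≤ σ p.1 z' * θ z' w * ϑ₂ p.1 p.2 := mul_le_mul_of_nonneg_right (hσθ p.1 z' w) (hϑ₂0 p.1 p.2)
          _ = σ p.1 z' * ϑ₂ p.1 p.2 * θ z' w := by ring)
      hDr hdθ hDc hdθ' (hbσ v) (fun z' => by rw [Fintype.sum_prod_type]; exact hg1c z') hαg1c hlamA1
    rw [Fintype.sum_prod_type] at h
    refine le_trans (sum_le_sum fun y _ => sum_le_sum fun z _ => ?_) h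
    refine mul_le_mul_of_nonneg_left ?_ (hE0' y z v)
    have hz := hϑmul v y z
    calc (ϑ v y * ϑ v z * ϑ y z) ≤ ϑ v y * (ϑ v y * ϑ y z) * ϑ y z := mul_le_mul_of_nonneg_right (mul_le_mul_of_nonneg_left hz (hϑ0 v y)) (hϑ0 y z)
      _ = ϑ v y * ϑ v y * (ϑ y z * ϑ y z) := by ring
      _ ≤ ϑ v y * ϑ v y * ϑ₂ y z := mul_le_mul_of_nonneg_left (hϑ2 y z) (mul_self_nonneg _)
  -- T5
  have h5 : ∑ y, ∑ z, (4 * Real.sqrt (5 * (κ₂ ^ 4 * γop ^ 2) / (1 - lam * γop) ^ 2 * (αθ * dθ * (βθ * dθ') / (1 - lamA))) / (ρ v y * ρ v z)) * (ϑ v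
        y * ϑ v z * ϑ y z) ≤ 4 * Real.sqrt (5 * (κ₂ ^ 4 * γop ^ 2) / (1 - lam * γop) ^ 2 * (αθ * dθ * (βθ * dθ') / (1 - lamA))) * Sϑ2 ^ 2 := by
    calc ∑ y, ∑ z, (4 * Real.sqrt (5 * (κ₂ ^ 4 * γop ^ 2) / (1 - lam * γop) ^ 2 * (αθ * dθ * (βθ * dθ') / (1 - lamA))) / (ρ v y * ρ v z)) * (ϑ v y
        * ϑ v z * ϑ y z)
        ≤ ∑ y, ∑ z, 4 * Real.sqrt (5 * (κ₂ ^ 4 * γop ^ 2) / (1 - lam * γop) ^ 2 * (αθ * dθ * (βθ * dθ') / (1 - lamA))) * ((ϑ v y * ϑ v y) * (ϑ v z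
        * ϑ v z) / (ρ v y * ρ v z)) := by
          refine sum_le_sum fun y _ => sum_le_sum fun z _ => ?_
          rw [div_mul_eq_mul_div, mul_div_assoc]
          exact mul_le_mul_of_nonneg_left (div_le_div_of_nonneg_right (hW v y z) (mul_pos (hρ0 v y) (hρ0 v z)).le) hCT
      _ = 4 * Real.sqrt (5 * (κ₂ ^ 4 * γop ^ 2) / (1 - lam * γop) ^ 2 * (αθ * dθ * (βθ * dθ') / (1 - lamA))) * ∑ y, ∑ z, (ϑ v y * ϑ v y) * (ϑ v z *
        ϑ v z) / (ρ v y * ρ v z) := by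
          rw [mul_sum]; exact sum_congr rfl fun y _ => by rw [mul_sum]
      _ ≤ 4 * Real.sqrt (5 * (κ₂ ^ 4 * γop ^ 2) / (1 - lam * γop) ^ 2 * (αθ * dθ * (βθ * dθ') / (1 - lamA))) * Sϑ2 ^ 2 := mul_le_mul_of_nonneg_left
        (tree_sq_sum_le hρ0 hS2 v) hCT
  simp only [add_mul, sum_add_distrib]
  linarith [h1, h2, h3, h4, h5]

/-- **`k3rϑ⁺`** (`x` fixed — the first index; full-graph weight `ϑ_{xy}ϑ_{xv}ϑ_{yv}`). [folklore] -/
theorem output_k3rϑ (hK30 : ∀ x y u, 0 ≤ K3 x y u) (hHk0 : ∀ v u, 0 ≤ Hk v u) (hD : ∀ x y, 0 ≤ D x y) (hlamA1 : lamA < 1)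
    (hθnn : ∀ z w, 0 ≤ θ z w) (hDr : ∀ z', ∑ w, D z' w * θ z' w ≤ dθ) (hdθ : 0 ≤ dθ) (hDc : ∀ w, ∑ z', D z' w * θ z' w ≤ dθ') (hdθ' : 0 ≤ dθ')
    (hσ0 : ∀ x w, 0 ≤ σ x w) (hσθ : ∀ x z' w, σ x w ≤ σ x z' * θ z' w)
    (hϑ1 : ∀ x y, 1 ≤ ϑ x y) (hϑsymm : ∀ x y, ϑ x y = ϑ y x) (hϑmul : ∀ x y z, ϑ x z ≤ ϑ x y * ϑ y z) (hϑ2 : ∀ x y, ϑ x y * ϑ x y ≤ ϑ₂ x y)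
    (hϑ₂1 : ∀ x y, 1 ≤ ϑ₂ x y) (hϑσ : ∀ x y w, ϑ x y * ϑ x y ≤ σ x w * σ y w) (hρ0 : ∀ x y, 0 < ρ x y) (hρsymm : ∀ x y, ρ x y = ρ y x)
    (hS2 : ∀ v, ∑ x, ϑ v x * ϑ v x / ρ v x ≤ Sϑ2) (hCT : 0 ≤ 4 * Real.sqrt (5 * (κ₂ ^ 4 * γop ^ 2) / (1 - lam * γop) ^ 2 * (αθ * dθ * (βθ * dθ') /
        (1 - lamA))))
    (hbσ : ∀ v, ∑ z', (∑ u, |A u z'| * Hk v u) * σ v z' ≤ αθ) (hbσc : ∀ z', ∑ v, (∑ u, |A u z'| * Hk v u) * σ v z' ≤ αθc) (hαθc : 0 ≤ αθc)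
    (hg1m : ∀ x, ∑ y, ϑ₂ x y * ∑ z', (∑ u, |A u z'| * K3 x y u) * σ x z' ≤ αg1m)
    (hg2m : ∀ y, ∑ x, ϑ₂ y x * ∑ z', (∑ u, |A u z'| * K3 x y u) * σ y z' ≤ αg2m)
    (hg1c : ∀ z', ∑ x, ∑ y, (∑ u, |A u z'| * K3 x y u) * (σ x z' * ϑ₂ x y) ≤ αg1c) (hαg1c : 0 ≤ αg1c)
    (hk3r : ∀ x, ∑ y, ∑ v, K3 x y v * (ϑ₂ x y * ϑ₂ x v * ϑ₂ y v) ≤ k3rϑ) (x : ι) :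
    ∑ y, ∑ v, (K3 x y v + ∑ w, (∑ z', D z' w * ∑ u, |A u z'| * K3 v y u) * (∑ z', D z' w * ∑ u, |A u z'| * Hk x u) / (1 - lamA) + ∑ w, (∑ z', D z'
        w * ∑ u, |A u z'| * K3 v x u) * (∑ z', D z' w * ∑ u, |A u z'| * Hk y u) / (1 - lamA) + ∑ w, (∑ z', D z' w * ∑ u, |A u z'| * Hk v u) * (∑
        z', D z' w * ∑ u, |A u z'| * K3 x y u) / (1 - lamA) + 4 * Real.sqrt (5 * (κ₂ ^ 4 * γop ^ 2) / (1 - lam * γop) ^ 2 * (αθ * dθ * (βθ * dθ') /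
        (1 - lamA))) / (ρ v x * ρ v y)) * (ϑ x y * ϑ x v * ϑ y v) ≤
      k3rϑ + (dθ * αθ * (dθ' * αg1c) / (1 - lamA) + dθ * αg2m * (dθ' * αθc) / (1 - lamA) + dθ * αg1m * (dθ' * αθc) / (1 - lamA)) + 4 * Real.sqrt (5
        * (κ₂ ^ 4 * γop ^ 2) / (1 - lam * γop) ^ 2 * (αθ * dθ * (βθ * dθ') / (1 - lamA))) * Sϑ2 ^ 2 := by
  have hl : 0 < 1 - lamA := by linarith
  have hϑ0 : ∀ x y, 0 ≤ ϑ x y := fun x y => zero_le_one.trans (hϑ1 x y)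
  have hϑ₂0 : ∀ x y, 0 ≤ ϑ₂ x y := fun x y => zero_le_one.trans (hϑ₂1 x y)
  have hϑϑ₂ : ∀ x y, ϑ x y ≤ ϑ₂ x y := fun x y => le_trans (by nlinarith [hϑ1 x y]) (hϑ2 x y)
  have hg0 : ∀ (p q : ι) (z' : κ), 0 ≤ ∑ u, |A u z'| * K3 p q u := fun p q z' => sum_nonneg fun u _ => mul_nonneg (abs_nonneg _) (hK30 p q u)
  have hb0 : ∀ (r : ι) (z' : κ), 0 ≤ ∑ u, |A u z'| * Hk r u := fun r z' => sum_nonneg fun u _ => mul_nonneg (abs_nonneg _) (hHk0 r u)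
  have hE0 : ∀ (p q r : ι), 0 ≤ ∑ w, (∑ z', D z' w * ∑ u, |A u z'| * K3 p q u) * (∑ z', D z' w * ∑ u, |A u z'| * Hk r u) / (1 - lamA) :=
    fun p q r => sum_nonneg fun w _ => div_nonneg (mul_nonneg (sum_nonneg fun z' _ => mul_nonneg (hD z' w) (hg0 p q z'))
      (sum_nonneg fun z' _ => mul_nonneg (hD z' w) (hb0 r z'))) hl.le
  have hE0' : ∀ (p q r : ι), 0 ≤ ∑ w, (∑ z', D z' w * ∑ u, |A u z'| * Hk r u) * (∑ z', D z' w * ∑ u, |A u z'| * K3 p q u) / (1 - lamA) :=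
    fun p q r => sum_nonneg fun w _ => div_nonneg (mul_nonneg (sum_nonneg fun z' _ => mul_nonneg (hD z' w) (hb0 r z'))
      (sum_nonneg fun z' _ => mul_nonneg (hD z' w) (hg0 p q z'))) hl.le
  -- the full-graph weight on a triangle with apex `a`: `ϑab·ϑac·ϑbc ≤ ϑab²·ϑac²`
  have hW : ∀ a b c, ϑ a b * ϑ a c * ϑ b c ≤ (ϑ a b * ϑ a b) * (ϑ a c * ϑ a c) := fun a b c => by
    have h := hϑmul b a c; rw [hϑsymm b a] at h
    calc ϑ a b * ϑ a c * ϑ b c ≤ ϑ a b * ϑ a c * (ϑ a b * ϑ a c) := mul_le_mul_of_nonneg_left h (mul_nonneg (hϑ0 a b) (hϑ0 a c))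
      _ = (ϑ a b * ϑ a b) * (ϑ a c * ϑ a c) := by ring
  have hW1 : ∀ a b c, ϑ a b * ϑ a c * ϑ b c ≤ ϑ₂ a b * (ϑ a c * ϑ a c) := fun a b c =>
    (hW a b c).trans (mul_le_mul_of_nonneg_right (hϑ2 a b) (mul_self_nonneg _))
  have hW2 : ∀ a b c, ϑ a b * ϑ a c * ϑ b c ≤ (ϑ a b * ϑ a b) * ϑ₂ a c := fun a b c =>
    (hW a b c).trans (mul_le_mul_of_nonneg_left (hϑ2 a c) (mul_self_nonneg _))
  have hW3 : ∀ a b c, ϑ a b * ϑ a c * ϑ b c ≤ ϑ₂ a b * ϑ₂ a c * ϑ₂ b c := fun a b c =>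
    mul_le_mul (mul_le_mul (hϑϑ₂ a b) (hϑϑ₂ a c) (hϑ0 a c) (hϑ₂0 a b)) (hϑϑ₂ b c) (hϑ0 b c) (mul_nonneg (hϑ₂0 a b) (hϑ₂0 a c))
  -- T1
  have h1 : ∑ y, ∑ v, K3 x y v * (ϑ x y * ϑ x v * ϑ y v) ≤ k3rϑ :=
    (sum_le_sum fun y _ => sum_le_sum fun v _ => mul_le_mul_of_nonneg_left (hW3 x y v) (hK30 x y v)).trans (hk3r x)
  -- T2: E(g^{vy}, b^x): one-point anchor b^x (second factor), family (y,v) ↦ g^{vy} with internal weight ϑ₂ v y: W ≤ ϑxv²·ϑ₂vy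
  have h2 : ∑ y, ∑ v, (∑ w, (∑ z', D z' w * ∑ u, |A u z'| * K3 v y u) * (∑ z', D z' w * ∑ u, |A u z'| * Hk x u) / (1 - lamA)) * (ϑ x y * ϑ x v * ϑ
        y v) ≤ dθ * αθ * (dθ' * αg1c) / (1 - lamA) := by
    have hβ : ∀ (p : ι × ι) (w : κ), ϑ x p.2 * ϑ x p.2 * ϑ₂ p.2 p.1 ≤ σ x w * (σ p.2 w * ϑ₂ p.2 p.1) := fun p w => by
      calc ϑ x p.2 * ϑ x p.2 * ϑ₂ p.2 p.1 ≤ σ x w * σ p.2 w * ϑ₂ p.2 p.1 := mul_le_mul_of_nonneg_right (hϑσ x p.2 w) (hϑ₂0 p.2 p.1)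
        _ = σ x w * (σ p.2 w * ϑ₂ p.2 p.1) := by ring
    have h := weighted_two_point_family_le (R := ι × ι) (a := fun z' => ∑ u, |A u z'| * Hk x u) (b := fun p z' => ∑ u, |A u z'| * K3 p.2 p.1 u)
      (σ := fun w => σ x w) (σ₁ := fun z' => σ x z') (σ' := fun p w => σ p.2 w * ϑ₂ p.2 p.1) (σ'₁ := fun p z' => σ p.2 z' * ϑ₂ p.2 p.1)
      (ϑ := fun p => ϑ x p.2 * ϑ x p.2 * ϑ₂ p.2 p.1) (fun z' => hb0 x z') (fun p z' => hg0 p.2 p.1 z') hD hθnn (fun w => hσ0 x w) (fun z' => hσ0 x z')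
      hβ (fun z' w => hσθ x z' w) (fun p z' w => by
        calc σ p.2 w * ϑ₂ p.2 p.1 ≤ σ p.2 z' * θ z' w * ϑ₂ p.2 p.1 := mul_le_mul_of_nonneg_right (hσθ p.2 z' w) (hϑ₂0 p.2 p.1)
          _ = σ p.2 z' * ϑ₂ p.2 p.1 * θ z' w := by ring)
      hDr hdθ hDc hdθ' (hbσ x) (fun z' => by rw [Fintype.sum_prod_type, sum_comm]; exact hg1c z') hαg1c hlamA1
    rw [Fintype.sum_prod_type] at h
    refine le_trans (sum_le_sum fun y _ => sum_le_sum fun v _ => ?_) h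
    refine mul_le_mul_of_nonneg_left ?_ (hE0 v y x)
    have hxy := hϑmul x v y
    calc (ϑ x y * ϑ x v * ϑ y v) ≤ (ϑ x v * ϑ v y) * ϑ x v * ϑ y v := (mul_le_mul_of_nonneg_right (mul_le_mul_of_nonneg_right hxy (hϑ0 x v)) (hϑ0 y
        v))
      _ = ϑ x v * ϑ x v * (ϑ v y * ϑ y v) := by ring
      _ = ϑ x v * ϑ x v * (ϑ v y * ϑ v y) := by rw [hϑsymm y v]
      _ ≤ ϑ x v * ϑ x v * ϑ₂ v y := mul_le_mul_of_nonneg_left (hϑ2 v y) (mul_self_nonneg _)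
  -- T3: E(g^{vx}, b^y): anchor family v ↦ g^{vx} (α = ϑ₂ x v), leg y (β = ϑxy²); anchor factor first; W ≤ ϑxy²·ϑxv² ≤ ϑxy²·ϑ₂xv
  have h3 : ∑ y, ∑ v, (∑ w, (∑ z', D z' w * ∑ u, |A u z'| * K3 v x u) * (∑ z', D z' w * ∑ u, |A u z'| * Hk y u) / (1 - lamA)) * (ϑ x y * ϑ x v * ϑ
        y v) ≤ dθ * αg2m * (dθ' * αθc) / (1 - lamA) := by
    have h := weighted_two_point_two_families_le' (R := ι) (S := ι) (g := fun v z' => ∑ u, |A u z'| * K3 v x u) (α := fun v => ϑ₂ x v)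
      (b := fun y z' => ∑ u, |A u z'| * Hk y u) (σ := fun w => σ x w) (σ₁ := fun z' => σ x z') (σ' := fun y w => σ y w) (σ'₁ := fun y z' => σ y z')
      (β := fun y => ϑ x y * ϑ x y) (fun v z' => hg0 v x z') (fun v => hϑ₂0 x v) (fun y z' => hb0 y z') hD hθnn (fun w => hσ0 x w)
      (fun z' => hσ0 x z') (fun y w => hϑσ x y w) (fun z' w => hσθ x z' w) (fun y z' w => hσθ y z' w) hDr hdθ hDc hdθ' (hg2m x) hbσc hαθc hlamA1
    rw [sum_comm] at h
    refine le_trans (sum_le_sum fun y _ => sum_le_sum fun v _ => ?_) h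
    exact mul_le_mul_of_nonneg_left ((hW2 x y v).trans (le_of_eq (by ring))) (hE0 v x y)
  -- T4: E(b^v, g^{xy}): anchor family y ↦ g^{xy} (α = ϑ₂ x y), leg v (β = ϑxv²); leg factor first
  have h4 : ∑ y, ∑ v, (∑ w, (∑ z', D z' w * ∑ u, |A u z'| * Hk v u) * (∑ z', D z' w * ∑ u, |A u z'| * K3 x y u) / (1 - lamA)) * (ϑ x y * ϑ x v * ϑ
        y v) ≤ dθ * αg1m * (dθ' * αθc) / (1 - lamA) := by
    have h := weighted_two_point_two_families_le (R := ι) (S := ι) (g := fun y z' => ∑ u, |A u z'| * K3 x y u) (α := fun y => ϑ₂ x y)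
      (b := fun v z' => ∑ u, |A u z'| * Hk v u) (σ := fun w => σ x w) (σ₁ := fun z' => σ x z') (σ' := fun v w => σ v w) (σ'₁ := fun v z' => σ v z')
      (β := fun v => ϑ x v * ϑ x v) (fun y z' => hg0 x y z') (fun y => hϑ₂0 x y) (fun v z' => hb0 v z') hD hθnn (fun w => hσ0 x w)
      (fun z' => hσ0 x z') (fun v w => hϑσ x v w) (fun z' w => hσθ x z' w) (fun v z' w => hσθ v z' w) hDr hdθ hDc hdθ' (hg1m x) hbσc hαθc hlamA1
    refine le_trans (sum_le_sum fun y _ => sum_le_sum fun v _ => ?_) h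
    exact mul_le_mul_of_nonneg_left ((hW1 x y v).trans (le_of_eq (by ring))) (hE0' x y v)
  -- T5: W ≤ ϑxv²·ϑvy² on the tree (v,x),(v,y)
  have h5 : ∑ y, ∑ v, (4 * Real.sqrt (5 * (κ₂ ^ 4 * γop ^ 2) / (1 - lam * γop) ^ 2 * (αθ * dθ * (βθ * dθ') / (1 - lamA))) / (ρ v x * ρ v y)) * (ϑ x
        y * ϑ x v * ϑ y v) ≤ 4 * Real.sqrt (5 * (κ₂ ^ 4 * γop ^ 2) / (1 - lam * γop) ^ 2 * (αθ * dθ * (βθ * dθ') / (1 - lamA))) * Sϑ2 ^ 2 := by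
    calc ∑ y, ∑ v, (4 * Real.sqrt (5 * (κ₂ ^ 4 * γop ^ 2) / (1 - lam * γop) ^ 2 * (αθ * dθ * (βθ * dθ') / (1 - lamA))) / (ρ v x * ρ v y)) * (ϑ x y
        * ϑ x v * ϑ y v)
        ≤ ∑ y, ∑ v, 4 * Real.sqrt (5 * (κ₂ ^ 4 * γop ^ 2) / (1 - lam * γop) ^ 2 * (αθ * dθ * (βθ * dθ') / (1 - lamA))) * ((ϑ x v * ϑ x v) * (ϑ v y
        * ϑ v y) / (ρ v x * ρ v y)) := by
          refine sum_le_sum fun y _ => sum_le_sum fun v _ => ?_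
          rw [div_mul_eq_mul_div, mul_div_assoc]
          refine mul_le_mul_of_nonneg_left (div_le_div_of_nonneg_right ?_ (mul_pos (hρ0 v x) (hρ0 v y)).le) hCT
          have hxy := hϑmul x v y
          calc (ϑ x y * ϑ x v * ϑ y v) ≤ (ϑ x v * ϑ v y) * ϑ x v * ϑ y v := (mul_le_mul_of_nonneg_right (mul_le_mul_of_nonneg_right hxy (hϑ0 x v))
        (hϑ0 y v))
            _ = (ϑ x v * ϑ x v) * (ϑ v y * ϑ y v) := by ring
            _ = (ϑ x v * ϑ x v) * (ϑ v y * ϑ v y) := by rw [hϑsymm y v]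
      _ = 4 * Real.sqrt (5 * (κ₂ ^ 4 * γop ^ 2) / (1 - lam * γop) ^ 2 * (αθ * dθ * (βθ * dθ') / (1 - lamA))) * ∑ y, ∑ v, (ϑ x v * ϑ x v) * (ϑ v y *
        ϑ v y) / (ρ v x * ρ v y) := by
          rw [mul_sum]; exact sum_congr rfl fun y _ => by rw [mul_sum]
      _ ≤ 4 * Real.sqrt (5 * (κ₂ ^ 4 * γop ^ 2) / (1 - lam * γop) ^ 2 * (αθ * dθ * (βθ * dθ') / (1 - lamA))) * Sϑ2 ^ 2 := mul_le_mul_of_nonneg_left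
        (tree_sq_sum_le' hρ0 hρsymm hS2 x) hCT
  simp only [add_mul, sum_add_distrib]
  linarith [h1, h2, h3, h4, h5]

/-! ## §3. Toy -/

/-- Toy (the apex inequality on numbers): `2·3·4 ≤ 2²·3²` (`ϑ_{bc} = 4 ≤ ϑ_{ab}ϑ_{ac} = 6`). -/
example : (2 : ℝ) * 3 * 4 ≤ (2 * 2) * (3 * 3) := by norm_num

end Summit.QuantumFields.BalabanUV.T4Continuum.NE7b.SupWeightedThirdOrderLetters

end
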